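import Literature.Analysis.FluidPDE.TypeIAncientMild
import Literature.Analysis.FluidPDE.SwirlTransportProofs
import Literature.Analysis.FluidPDE.AxisymmetricHeatFlow
import Literature.Analysis.FluidPDE.OseenKernelLineIntegrals
import Literature.Analysis.FluidPDE.KNSSOseenMildDecayTools
import Literature.Analysis.FluidPDE.KatoSymmetryCovariance
import HarnessLib

/-!
# `AxisymEndLiouville` (stmt-NavierStokesRegularity-14061), line
# `absorbing-axis-swirl-extinction`: stub `stub_axisNormalForm` (axis normal form + transfer)

For `u` in the Type I ancient mild class `𝒜_C` (`IsTypeIAncientMild C u`) annihilated on a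
backward end `t < θ ≤ 0` by the rotation field `x ↦ A (x - c)` of a nonzero skew `A` of `ℝ³`, we
produce `v ∈ 𝒜_C`, axisymmetric about the VERTICAL axis through `0` in the integrated sense
`v t (R_φ y) = R_φ (v t y)` for ALL `t < 0`, such that `v ≡ 0` on `t < 0` forces `u ≡ 0` on
`t < θ`: `v t y = L (u (t + θ) (L⁻¹ y + c))` for a linear isometry `L` with `L A L⁻¹ = α J`,
`α ≠ 0`, `J = rotGen` (a nonzero skew map of `ℝ³` has a kernel vector `w`; a Householder
reflection takes `w` to `‖w‖ e₂`; a skew map killing `e₂` is `α J`). Ingredients: covariance of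
`𝒜_C` under linear isometries (equivariance of the heat and Oseen–Koch–Tataru kernels, trace
invariance of the divergence), space translations and time shifts (the tree's
`IsTypeIAncientMild.comp_sub_right`), and infinitesimal ⇒ integrated axisymmetry.
-/

noncomputable section

-- the summit and its single problem share the name (D-0017 nested layout)
set_option linter.dupNamespace false

open MeasureTheory Set Function Filter Topology WithLp
open scoped RealInnerProductSpace ContDiff

namespace Summit.NavierStokesRegularity.NavierStokesRegularity.Theorems.AxisymEndLiouville.AbsorbingAxisSwirlExtinction

open Literature.Analysis Literature.Analysis.FluidPDE

/-- Local notation for physical space `ℝ³`. -/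
local notation "E3" => EuclideanSpace ℝ (Fin 3)

/-! ### Covariance of the class `𝒜_C` under linear isometries and translations -/

section General

-- The rotation covariance block is adapted from Cruxes/HelicalEndLiouville/Disproof.lean; it is
-- also in Theorems/SymmetryModuliCountSymmetricLiouvilleRotationCovariance.lean, a module the check
-- farm does not serve yet — hence private verbatim copies here (switch to the import when served).
-- `isTypeIAncientMild_comp_add` is adapted from Cruxes/AxisymEndLiouville/Disproof.lean.

variable {E : Type*} [NormedAddCommGroup E] [InnerProductSpace ℝ E]

/-- The Oseen–Koch–Tataru kernel is equivariant under linear isometries: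
`K(τ, L z)[L a, L b] = L (K(τ, z)[a, b])` (inner products and radial weights). [folklore] -/
private theorem oseenKernel_map_linearIsometryEquiv (L : E ≃ₗᵢ[ℝ] E) (τ : ℝ) (z a b : E) :
    oseenKernel τ (L z) (L a) (L b) = L (oseenKernel τ z a b) := by
  have hn : ‖L z‖ = ‖z‖ := L.norm_map z
  simp only [oseenKernel, LinearIsometryEquiv.inner_map_map, heatKernel_eq_of_norm_eq hn,
    oseenWeightA_eq_of_norm_eq hn, oseenWeightB_eq_of_norm_eq hn, map_add, map_sub,
    LinearIsometryEquiv.map_smul]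

/-- A linear isometric equivalence commutes with the Bochner integral. [folklore] -/
private theorem integral_linearIsometryEquiv_comm {X : Type*} [MeasurableSpace X] (μ : Measure X)
    (L : E ≃ₗᵢ[ℝ] E) (f : X → E) : ∫ x, L (f x) ∂μ = L (∫ x, f x ∂μ) :=
  L.toContinuousLinearEquiv.integral_comp_comm f

/-- The Fréchet derivative of a conjugate field `z ↦ L (φ (L⁻¹ z))` (chain rule). [folklore] -/
private theorem hasFDerivAt_conj (L : E ≃ₗᵢ[ℝ] E) {φ : E → E} (hd : Differentiable ℝ φ) (y : E) :
    HasFDerivAt (fun z => L (φ (L.symm z)))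
      ((L.toContinuousLinearEquiv : E →L[ℝ] E).comp ((fderiv ℝ φ (L.symm y)).comp
        (L.symm.toContinuousLinearEquiv : E →L[ℝ] E))) y := by
  have hC : HasFDerivAt (fun z : E => L z) (L.toContinuousLinearEquiv : E →L[ℝ] E)
      (φ (L.symm y)) := L.toContinuousLinearEquiv.hasFDerivAt
  exact (hC.comp (L.symm y) (hd _).hasFDerivAt).comp y L.symm.toContinuousLinearEquiv.hasFDerivAt

/-- The derivative of a conjugate field, applied: `D(L φ L⁻¹)(y) h = L (Dφ(L⁻¹ y) (L⁻¹ h))`. [folklore] -/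
private theorem fderiv_conj_apply (L : E ≃ₗᵢ[ℝ] E) {φ : E → E} (hd : Differentiable ℝ φ) (y h : E) :
    fderiv ℝ (fun z => L (φ (L.symm z))) y h = L (fderiv ℝ φ (L.symm y) (L.symm h)) := by
  rw [(hasFDerivAt_conj L hd y).fderiv]
  rfl

/-- The divergence is invariant under conjugation by a linear isometry:
`div (L φ L⁻¹)(x) = div φ (L⁻¹ x)` for differentiable `φ` (`tr (L D L⁻¹) = tr D`). [folklore] -/
private theorem divergence_conj_linearIsometryEquiv (L : E ≃ₗᵢ[ℝ] E) {φ : E → E}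
    (hd : Differentiable ℝ φ) (x : E) :
    VectorCalculus.divergence (fun y => L (φ (L.symm y))) x =
      VectorCalculus.divergence φ (L.symm x) := by
  unfold VectorCalculus.divergence
  rw [(hasFDerivAt_conj L hd x).fderiv]
  have key : ((L.toContinuousLinearEquiv : E →L[ℝ] E).comp ((fderiv ℝ φ (L.symm x)).comp
      (L.symm.toContinuousLinearEquiv : E →L[ℝ] E)) : E →ₗ[ℝ] E) =
      L.toLinearEquiv.conj (fderiv ℝ φ (L.symm x) : E →ₗ[ℝ] E) := by
    ext v
    simp [LinearEquiv.conj_apply]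
  rw [key, LinearMap.trace_conj']

variable [FiniteDimensional ℝ E] [MeasurableSpace E] [BorelSpace E]

/-- The Oseen–Duhamel term is covariant under linear isometries:
`B^ν_s(L u L⁻¹, L v L⁻¹)(t)(x) = L (B^ν_s(u, v)(t)(L⁻¹ x))` (substitute `y = L y'`). [folklore] -/
private theorem oseenDuhamel_conj_linearIsometryEquiv (L : E ≃ₗᵢ[ℝ] E) (ν s : ℝ) (u v : ℝ → E → E)
    (t : ℝ) (x : E) :
    oseenDuhamel ν s (fun τ y => L (u τ (L.symm y))) (fun τ y => L (v τ (L.symm y))) t x =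
      L (oseenDuhamel ν s u v t (L.symm x)) := by
  simp only [oseenDuhamel_apply]
  rw [← integral_linearIsometryEquiv_comm]
  refine setIntegral_congr_fun measurableSet_Ioo fun τ _ => ?_
  rw [← integral_linearIsometryEquiv_comm]
  have hmp : MeasurePreserving L volume volume := L.measurePreserving
  rw [← hmp.integral_comp L.toHomeomorph.measurableEmbedding
    (fun y => oseenKernel (ν * (t - τ)) (x - y) (L (u τ (L.symm y))) (L (v τ (L.symm y))))]
  congr 1
  funext y
  have e : x - L y = L (L.symm x - y) := by simp [map_sub]
  simp only [LinearIsometryEquiv.symm_apply_apply]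
  rw [e, oseenKernel_map_linearIsometryEquiv]

/-- The heat flow is covariant under linear isometries:
`e^{σΔ}(L φ L⁻¹)(x) = L (e^{σΔ}φ)(L⁻¹ x)` for every `σ`. [folklore] -/
private theorem heatFlow_conj_linearIsometryEquiv (L : E ≃ₗᵢ[ℝ] E) (φ : E → E) (σ : ℝ) (x : E) :
    heatFlow (fun y => L (φ (L.symm y))) σ x = L (heatFlow φ σ (L.symm x)) := by
  rcases le_or_gt σ 0 with h | h
  · simp [heatFlow_of_nonpos _ h]
  · rw [heatFlow_of_pos _ h, heatFlow_of_pos _ h,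
      heatExtension_comp_linearIsometryEquiv L.symm (fun z => L (φ z)) σ x]
    rw [show (fun z => L (φ z)) = fun z => L.toContinuousLinearEquiv (φ z) from rfl,
      heatExtension_continuousLinearEquiv_comp]
    rfl

/-- **`𝒜_C` is invariant under linear isometries**: `u ∈ 𝒜_C ⇒ ((t, x) ↦ L (u t (L⁻¹ x))) ∈ 𝒜_C`
(KNSS 2009, §1: the symmetries of the problem). [folklore] -/
private theorem isTypeIAncientMild_conj_linearIsometryEquiv {C : ℝ} {u : ℝ → E → E}
    (h : IsTypeIAncientMild C u) (L : E ≃ₗᵢ[ℝ] E) :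
    IsTypeIAncientMild C (fun t x => L (u t (L.symm x))) := by
  refine ⟨?_, fun t ht => ?_, fun s t hst ht x => ?_, fun t ht x => ?_⟩
  · have e : uncurry (fun t x => L (u t (L.symm x))) =
        (fun z : E => L.toContinuousLinearEquiv z) ∘ uncurry u ∘
          fun p : ℝ × E => (p.1, L.symm.toContinuousLinearEquiv p.2) := by
      funext p; rfl
    rw [e]
    refine L.toContinuousLinearEquiv.contDiff.comp_contDiffOn (h.contDiffOn.comp ?_ ?_)
    · exact (contDiff_fst.prodMk
        (L.symm.toContinuousLinearEquiv.contDiff.comp contDiff_snd)).contDiffOn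
    · intro p hp
      exact ⟨hp.1, mem_univ _⟩
  · intro x
    rw [divergence_conj_linearIsometryEquiv L ((h.contDiff_slice ht).differentiable (by simp)) x]
    exact h.isDivFree ht _
  · show L (u t (L.symm x)) = heatFlow (fun y => L (u s (L.symm y))) (t - s) x -
        oseenDuhamel 1 s (fun τ y => L (u τ (L.symm y))) (fun τ y => L (u τ (L.symm y))) t x
    rw [oseenDuhamel_conj_linearIsometryEquiv, heatFlow_conj_linearIsometryEquiv,
      h.mild_eq hst ht (L.symm x), map_sub]
  · show ‖L (u t (L.symm x))‖ ≤ C / Real.sqrt (-t)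
    rw [LinearIsometryEquiv.norm_map]
    exact h.norm_le ht _

/-- **`𝒜_C` is invariant under space translations** `u ↦ u(·, · + a)` (KNSS 2009, §1: every
clause commutes with translations; the tree's `heatFlow_comp_add_right`,
`oseenDuhamel_comp_add_right`, `fderiv_comp_add_right`). [folklore] -/
theorem isTypeIAncientMild_comp_add {C : ℝ} {u : ℝ → E → E} (hu : IsTypeIAncientMild C u)
    (a : E) : IsTypeIAncientMild C (fun t x => u t (x + a)) := by
  refine ⟨?_, fun t ht x => ?_, fun s t hst ht x => ?_, fun t ht x => hu.norm_le ht (x + a)⟩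
  · have e : (uncurry fun t x => u t (x + a)) = uncurry u ∘ fun p : ℝ × E => (p.1, p.2 + a) :=
      rfl
    rw [e]
    refine hu.contDiffOn.comp
      ((contDiff_fst.prodMk (contDiff_snd.add contDiff_const)).contDiffOn) ?_
    rintro ⟨t, x⟩ ⟨ht, -⟩
    exact ⟨ht, mem_univ _⟩
  · have hx := hu.isDivFree ht (x + a)
    simp only [VectorCalculus.divergence] at hx ⊢
    rwa [fderiv_comp_add_right]
  · show u t (x + a) = heatFlow (fun y => u s (y + a)) (t - s) x -
        oseenDuhamel 1 s (fun τ y => u τ (y + a)) (fun τ y => u τ (y + a)) t x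
    rw [heatFlow_comp_add_right, oseenDuhamel_comp_add_right]
    exact hu.mild_eq hst ht (x + a)

end General

/-! ### Linear algebra: nonzero skew maps of `ℝ³` are conjugate to `α J`, `α ≠ 0` -/

/-- Polarisation: `⟪A x, x⟫ = 0` for all `x` gives `⟪A x, y⟫ = -⟪A y, x⟫`. [folklore] -/
private theorem inner_map_swap_of_skew {A : E3 →L[ℝ] E3} (hskew : ∀ x, ⟪A x, x⟫ = 0) (x y : E3) :
    ⟪A x, y⟫ = -⟪A y, x⟫ := by
  have h := hskew (x + y)
  rw [map_add, inner_add_left, inner_add_right, inner_add_right, hskew x, hskew y] at h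
  linarith

/-- Matrix entries of a skew map are antisymmetric: `(A e_j)_i = -(A e_i)_j`. [folklore] -/
private theorem apply_single_skew {A : E3 →L[ℝ] E3} (hskew : ∀ x, ⟪A x, x⟫ = 0) (i j : Fin 3) :
    A (EuclideanSpace.single j 1) i = -A (EuclideanSpace.single i 1) j := by
  have h := inner_map_swap_of_skew hskew (EuclideanSpace.single j 1) (EuclideanSpace.single i 1)
  simpa [EuclideanSpace.inner_single_right] using h

/-- Expansion along the standard basis: `A x = x₀ A e₀ + x₁ A e₁ + x₂ A e₂`. [folklore] -/
private theorem clm_apply_eq_sum_three (A : E3 →L[ℝ] E3) (x : E3) :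
    A x = x 0 • A (EuclideanSpace.single 0 1) + x 1 • A (EuclideanSpace.single 1 1) +
      x 2 • A (EuclideanSpace.single 2 1) := by
  have hx : x = x 0 • EuclideanSpace.single (0 : Fin 3) (1 : ℝ) +
      x 1 • EuclideanSpace.single (1 : Fin 3) (1 : ℝ) +
      x 2 • EuclideanSpace.single (2 : Fin 3) (1 : ℝ) := by
    ext i; fin_cases i <;> simp
  conv_lhs => rw [hx]
  simp only [map_add, map_smul]

/-- **A nonzero skew map of `ℝ³` has a nonzero kernel vector**: with `a_{ij} = (A e_j)_i`, the
vector `w = (a₂₁, a₀₂, a₁₀)` has `A w = 0` (`A x = w × x`), and `w = 0` forces `A = 0`. [folklore] -/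
theorem exists_ne_zero_map_eq_zero_of_skew {A : E3 →L[ℝ] E3} (hskew : ∀ x, ⟪A x, x⟫ = 0)
    (hA : A ≠ 0) : ∃ w : E3, w ≠ 0 ∧ A w = 0 := by
  have h00 : A (EuclideanSpace.single 0 1) 0 = 0 := by linarith [apply_single_skew hskew 0 0]
  have h11 : A (EuclideanSpace.single 1 1) 1 = 0 := by linarith [apply_single_skew hskew 1 1]
  have h22 : A (EuclideanSpace.single 2 1) 2 = 0 := by linarith [apply_single_skew hskew 2 2]
  obtain ⟨h01, h02, h12⟩ := And.intro (apply_single_skew hskew 0 1)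
    (And.intro (apply_single_skew hskew 0 2) (apply_single_skew hskew 1 2))
  refine ⟨toLp 2 ![A (EuclideanSpace.single 1 1) 2, -A (EuclideanSpace.single 0 1) 2,
    A (EuclideanSpace.single 0 1) 1], fun hw => hA ?_, ?_⟩
  · -- `w = 0`: all nine entries vanish, so `A = 0`
    have hq2 : A (EuclideanSpace.single 1 1) 2 = 0 := by
      simpa using congrArg (fun v : E3 => v 0) hw
    have hp2 : A (EuclideanSpace.single 0 1) 2 = 0 := by
      simpa using congrArg (fun v : E3 => v 1) hw
    have hp1 : A (EuclideanSpace.single 0 1) 1 = 0 := by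
      simpa using congrArg (fun v : E3 => v 2) hw
    ext x i
    rw [clm_apply_eq_sum_three A x]
    fin_cases i <;> simp [h00, h11, h22, h01, h02, h12, hq2, hp2, hp1]
  · rw [clm_apply_eq_sum_three]
    ext i
    fin_cases i <;> simp [h00, h11, h22, h01, h02, h12] <;> ring

/-- **A skew map of `ℝ³` killing `e₂` is a multiple of the generator `J`**:
`B y = (B e₀)₁ • J y` (`B e₀ = α e₁`, `B e₁ = -α e₀`, `B e₂ = 0`). [folklore] -/
theorem eq_smul_rotGen_of_skew {B : E3 →L[ℝ] E3} (hskew : ∀ x, ⟪B x, x⟫ = 0)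
    (h2 : B (EuclideanSpace.single 2 1) = 0) (y : E3) :
    B y = (B (EuclideanSpace.single 0 1) 1) • rotGen y := by
  have h00 : B (EuclideanSpace.single 0 1) 0 = 0 := by linarith [apply_single_skew hskew 0 0]
  have h11 : B (EuclideanSpace.single 1 1) 1 = 0 := by linarith [apply_single_skew hskew 1 1]
  have h01 := apply_single_skew hskew 0 1
  have h20 : B (EuclideanSpace.single 0 1) 2 = 0 := by
    rw [apply_single_skew hskew 2 0, h2]; simp
  have h21 : B (EuclideanSpace.single 1 1) 2 = 0 := by
    rw [apply_single_skew hskew 2 1, h2]; simp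
  rw [clm_apply_eq_sum_three B y, h2, smul_zero, add_zero]
  ext i
  fin_cases i <;> simp [rotGen, h00, h11, h01, h20, h21] <;> ring

/-- **Normal form of a nonzero skew map of `ℝ³`**: there are a linear isometry `L` and `α ≠ 0`
with `L A L⁻¹ = α J`, `J = rotGen` the generator of the rotations about the vertical axis
(rotate a kernel vector `w` of `A` onto `‖w‖ e₂` by a Householder reflection). [folklore] -/
theorem exists_conj_eq_smul_rotGen {A : E3 →L[ℝ] E3} (hskew : ∀ x, ⟪A x, x⟫ = 0) (hA : A ≠ 0) :
    ∃ L : E3 ≃ₗᵢ[ℝ] E3, ∃ α : ℝ, α ≠ 0 ∧ ∀ y, L (A (L.symm y)) = α • rotGen y := by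
  obtain ⟨w, hw, hAw⟩ := exists_ne_zero_map_eq_zero_of_skew hskew hA
  have hn : ‖w‖ = ‖(EuclideanSpace.single (2 : Fin 3) ‖w‖ : E3)‖ := by simp
  obtain ⟨L, hLw⟩ : ∃ L : E3 ≃ₗᵢ[ℝ] E3, L w = EuclideanSpace.single 2 ‖w‖ :=
    ⟨_, Submodule.reflection_sub hn⟩
  obtain ⟨B, hB⟩ : ∃ B : E3 →L[ℝ] E3, ∀ y, B y = L (A (L.symm y)) :=
    ⟨(L.toContinuousLinearEquiv : E3 →L[ℝ] E3).comp
      (A.comp (L.symm.toContinuousLinearEquiv : E3 →L[ℝ] E3)), fun y => rfl⟩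
  have hBskew : ∀ y, ⟪B y, y⟫ = 0 := fun y => by
    rw [hB, LinearIsometryEquiv.inner_map_eq_flip]
    exact hskew _
  have hB2 : B (EuclideanSpace.single 2 1) = 0 := by
    have hnorm : ‖w‖ ≠ 0 := norm_ne_zero_iff.2 hw
    have e : (EuclideanSpace.single (2 : Fin 3) (1 : ℝ) : E3) = ‖w‖⁻¹ • L w := by
      rw [hLw]; ext i; fin_cases i <;> simp [hnorm]
    rw [e, map_smul, hB, L.symm_apply_apply, hAw, map_zero, smul_zero]
  refine ⟨L, B (EuclideanSpace.single 0 1) 1, fun hα => hA ?_, fun y => ?_⟩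
  · -- `α = 0` would give `B = 0`, hence `A = 0`
    ext1 x
    have hx := eq_smul_rotGen_of_skew hBskew hB2 (L x)
    rw [hα, zero_smul, hB, L.symm_apply_apply] at hx
    simpa using congrArg L.symm hx
  · rw [← hB]
    exact eq_smul_rotGen_of_skew hBskew hB2 y

/-! ### Infinitesimal versus integrated axisymmetry -/

-- adapted from Cruxes/AxisymEndLiouville/Disproof.lean (`isAxisymmetric_of_fderiv_rotGen`)

/-- `R_{−θ} v = −cos θ • J(Jv) − sin θ • Jv + (v + J(Jv))` (`J(Jv) = −v_h`). [folklore] -/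
theorem rotZ_neg_eq (θ : ℝ) (v : E3) : rotZ (-θ) v =
    (-Real.cos θ) • rotGen (rotGen v) - Real.sin θ • rotGen v + (v + rotGen (rotGen v)) := by
  ext i
  fin_cases i <;> (simp [rotZ, rotGen, Real.cos_neg, Real.sin_neg]; try ring)

/-- The orbit `θ ↦ R_θ x` has velocity `J (R_θ x)`. [folklore] -/
theorem hasDerivAt_rotZ_rotGen (x : E3) (θ : ℝ) :
    HasDerivAt (fun θ => rotZ θ x) (rotGen (rotZ θ x)) θ := by
  refine (hasDerivAt_rotZ x θ).congr_deriv ?_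
  ext i
  fin_cases i <;> (simp [rotZ, rotGen]; try ring)

/-- **Infinitesimal ⇒ integrated axisymmetry** (converse of `IsAxisymmetric.fderiv_rotGen`): a
differentiable field with `Df(x)[Jx] = J f(x)` everywhere is equivariant under all rotations
about the vertical axis (`g(θ) = R_{−θ} f(R_θ x)` has `g' ≡ 0`, `J³ = −J`). [folklore] -/
theorem isAxisymmetric_of_fderiv_rotGen {f : E3 → E3} (hf : Differentiable ℝ f)
    (h : ∀ x, fderiv ℝ f x (rotGen x) = rotGen (f x)) : IsAxisymmetric f := by
  intro θ x
  set F : ℝ → E3 := fun s => f (rotZ s x) with hF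
  have hF' : ∀ s, HasDerivAt F (rotGen (F s)) s := fun s => by
    have h1 := (hf (rotZ s x)).hasFDerivAt.comp_hasDerivAt s (hasDerivAt_rotZ_rotGen x s)
    rw [h (rotZ s x)] at h1
    exact h1
  have hJF : ∀ s, HasDerivAt (fun s => rotGenL (F s)) (rotGenL (rotGen (F s))) s :=
    fun s => rotGenL.hasFDerivAt.comp_hasDerivAt s (hF' s)
  have hJJF : ∀ s, HasDerivAt (fun s => rotGenL (rotGenL (F s)))
      (rotGenL (rotGenL (rotGen (F s)))) s :=
    fun s => rotGenL.hasFDerivAt.comp_hasDerivAt s (hJF s)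
  set g : ℝ → E3 := fun s => rotZ (-s) (F s) with hg
  have hg_eq : g = fun s => (-Real.cos s) • rotGenL (rotGenL (F s)) -
      Real.sin s • rotGenL (F s) + (F s + rotGenL (rotGenL (F s))) := by
    funext s
    simp only [hg, rotGenL_apply]
    exact rotZ_neg_eq s (F s)
  have hg' : ∀ s, HasDerivAt g 0 s := by
    intro s
    have h4 := (((Real.hasDerivAt_cos s).fun_neg.fun_smul (hJJF s)).fun_sub
      ((Real.hasDerivAt_sin s).fun_smul (hJF s))).fun_add ((hF' s).fun_add (hJJF s))
    rw [hg_eq]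
    refine h4.congr_deriv ?_
    simp only [rotGenL_apply]
    ext i
    fin_cases i <;> (simp [rotGen]; try ring)
  have hconst : g θ = g 0 :=
    is_const_of_deriv_eq_zero (fun s => (hg' s).differentiableAt) (fun s => (hg' s).deriv) θ 0
  have hg0 : g 0 = f x := by simp [hg, hF]
  calc f (rotZ θ x) = rotZ θ (rotZ (-θ) (f (rotZ θ x))) := by
        rw [← rotZ_add, add_neg_cancel, rotZ_zero]
    _ = rotZ θ (g θ) := rfl
    _ = rotZ θ (f x) := by rw [hconst, hg0]

/-! ### Symmetry transport and the stub -/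

/-- **Symmetry transport.** If `Dφ(x)[A(x − c)] = A φ(x)` for all `x` and `L A L⁻¹ = α J` with
`α ≠ 0`, then `ψ(z) = L φ(L⁻¹ z + c)` satisfies the infinitesimal axisymmetry `Dψ(y)[J y] = J ψ(y)`
about the vertical axis through the origin. [folklore] -/
theorem fderiv_normalised_rotGen {φ : E3 → E3} (hφ : Differentiable ℝ φ) (L : E3 ≃ₗᵢ[ℝ] E3)
    {A : E3 →L[ℝ] E3} {α : ℝ} (hα : α ≠ 0) (hconj : ∀ y, L (A (L.symm y)) = α • rotGen y)
    (c : E3) (hsym : ∀ x, fderiv ℝ φ x (A (x - c)) = A (φ x)) (y : E3) :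
    fderiv ℝ (fun z => L (φ (L.symm z + c))) y (rotGen y) = rotGen (L (φ (L.symm y + c))) := by
  have hd : Differentiable ℝ (fun x => φ (x + c)) := hφ.comp (differentiable_id.add_const c)
  have e1 := fderiv_conj_apply L hd y (rotGen y)
  have e2 : L.symm (rotGen y) = α⁻¹ • A (L.symm y) := by
    apply L.injective
    rw [L.apply_symm_apply, L.map_smul, hconj y, smul_smul, inv_mul_cancel₀ hα, one_smul]
  have e3 := hsym (L.symm y + c)
  rw [add_sub_cancel_right] at e3
  have e4 := hconj (L (φ (L.symm y + c)))
  rw [L.symm_apply_apply] at e4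
  rw [e1, fderiv_comp_add_right, e2, map_smul, e3, L.map_smul, e4, smul_smul,
    inv_mul_cancel₀ hα, one_smul]

/-- STUB 1 of the line `absorbing-axis-swirl-extinction` (**axis normal form + transfer**). For
`u ∈ 𝒜_C` annihilated on `t < θ ≤ 0` by the rotation field `x ↦ A (x − c)` of a nonzero skew `A`,
there is `v ∈ 𝒜_C`, axisymmetric about the vertical axis (integrated sense) for ALL `t < 0`,
whose vanishing on `t < 0` gives `u ≡ 0` on `t < θ`: `v(t, y) = L (u (t + θ, L⁻¹ y + c))` with
`L A L⁻¹ = α J`, `α ≠ 0` (`exists_conj_eq_smul_rotGen`); `v ∈ 𝒜_C` by time-shift, translation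
and rotation covariance of the class; the transported infinitesimal symmetry `Dv(y)[Jy] = J v(y)`
(`fderiv_normalised_rotGen`) integrates to `v t (R_φ y) = R_φ (v t y)`. [folklore] -/
theorem stub_axisNormalForm (C : ℝ) (u : ℝ → E3 → E3) (hu : IsTypeIAncientMild C u)
    (c : E3) (A : E3 →L[ℝ] E3) (θ : ℝ) (hskew : ∀ x, ⟪A x, x⟫ = 0) (hA : A ≠ 0) (hθ : θ ≤ 0)
    (hsym : ∀ t < θ, ∀ x, fderiv ℝ (u t) x (A (x - c)) - A (u t x) = 0) :
    ∃ v : ℝ → E3 → E3, IsTypeIAncientMild C v ∧ (∀ t < 0, IsAxisymmetric (v t)) ∧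
      ((∀ t < 0, ∀ y, v t y = 0) → ∀ t < θ, ∀ x, u t x = 0) := by
  obtain ⟨L, α, hα, hconj⟩ := exists_conj_eq_smul_rotGen hskew hA
  -- the three covariances: time shift by `-θ ≥ 0`, translation by `c`, conjugation by `L`
  have h₁ : IsTypeIAncientMild C (fun t => u (t + θ)) := by
    simpa only [sub_neg_eq_add] using hu.comp_sub_right (neg_nonneg.2 hθ)
  have h₃ : IsTypeIAncientMild C (fun t y => L (u (t + θ) (L.symm y + c))) :=
    isTypeIAncientMild_conj_linearIsometryEquiv (isTypeIAncientMild_comp_add h₁ c) L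
  refine ⟨fun t y => L (u (t + θ) (L.symm y + c)), h₃, fun t ht => ?_, fun hzero t ht x => ?_⟩
  · -- integrated axisymmetry of the slice at time `t < 0` (`t + θ < θ`)
    have hs : t + θ < θ := by linarith
    have hφ : Differentiable ℝ (u (t + θ)) :=
      (hu.contDiff_slice (lt_of_lt_of_le hs hθ)).differentiable (by simp)
    exact isAxisymmetric_of_fderiv_rotGen ((h₃.contDiff_slice ht).differentiable (by simp))
      (fderiv_normalised_rotGen hφ L hα hconj c fun x => sub_eq_zero.1 (hsym (t + θ) hs x))
  · -- transfer back: `u t x = L⁻¹ (v (t - θ) (L (x - c)))`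
    simpa using congrArg L.symm (hzero (t - θ) (by linarith) (L (x - c)))

end Summit.NavierStokesRegularity.NavierStokesRegularity.Theorems.AxisymEndLiouville.AbsorbingAxisSwirlExtinction

end
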